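import Literature.MathematicalPhysics.QuantumLattice.HubbardNNNHoppingOpenClusters
import Literature.MathematicalPhysics.QuantumLattice.FermionOperatorsProofs
import Literature.MathematicalPhysics.QuantumLattice.HubbardAtomicLimit
import Mathlib.Combinatorics.Colex
import HarnessLib

/-!
# Occupation codes: the open-cluster `t–t'` Hubbard Hamiltonian as an explicit integer-coded matrix

Topic `MathematicalPhysics/QuantumLattice`, family `hubbard`. The tree's Fock space over the orbitals
`Orb Λ = Λ ×ₗ Fin 2` is `Finset (Orb Λ) → ℂ` with the Jordan–Wigner matrices `annihilation`,
`creation` (`HubbardWave0`, `FermionOperatorsProofs`). For exact-diagonalisation CERTIFICATES that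
the kernel checks by evaluation one needs the matrix entries of the open-cluster Hamiltonian
`hubbardOpenBoxTT' a b t t' U` (`HubbardNNNHoppingOpenClusters`) as a COMPUTABLE function of
integer codes of the occupation configurations. This file provides that dictionary:

* §1 `bitCount m k` (set bits of `m` below `k`), `natCode S = Σ_{i ∈ S} 2^i` for `S : Finset ℕ`,
  with `testBit_natCode`, `bitCount_natCode` (= `#{i ∈ S | i < k}`), `natCode_insert/erase`;
* §2 the orbital rank `orbRank (x, σ) = 2·(i·b + j) + σ` of the open `a × b` box (`x = (i, j)` in
  `Fin a ×ₗ Fin b`), an order embedding `Orb (Fin a ×ₗ Fin b) ↪o ℕ` (`orbRank_lt_iff`), the code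
  `code s = Σ_{o ∈ s} 2^{orbRank o}`, and the dictionary `mem_iff_testBit_code`, `code_insert`,
  `code_erase`, `code_injective`, **`jwSign_eq_neg_one_pow_bitCount`** (the Jordan–Wigner sign is
  the parity of the set bits below the orbital's rank);
* §3 the entries of a hopping word `(c†_i c_j) s s'` (`creation_mul_annihilation_apply`), of the
  double occupancy (`numberOp_mul_numberOp_apply`) and of the Hubbard Hamiltonian of ANY graph
  (`hamiltonian_apply`), in `Finset` language.

The companion file `HubbardOpenBoxCodedHamiltonian` turns these into the integer-coded entry
functions `hopCode`, `openBoxHopNN`, `openBoxHopDiag`, `doccCode` and the dictionary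
`hubbardOpenBoxTT' a b t t' U s s' = -t·openBoxHopNN … - t'·openBoxHopDiag … + U·doccCode …`.

Everything is proved; no named fact. Sources: the Jordan–Wigner representation (Jordan–Wigner 1928;
Essler–Frahm–Göhmann–Klümper–Korepin 2005 §2.1, §12.3.4) and the standard bit-coded
exact-diagonalisation basis of the Hubbard model (Lin–Gubernatis, *Exact diagonalization methods for
quantum systems*, Computers in Physics 7 (1993) 400, §II: integer codes `I = Σ 2^i` of the up/down
occupations, fermion signs by counting set bits between the two orbitals).

## Mathlib / tree search

REUSED: `Finset.toFinset_bitIndices_sum_two_pow`, `Nat.mem_bitIndices`, `Finset.geomSum_injective`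
(Mathlib `Combinatorics.Colex`), `annihilation_apply`, `creation_apply`, `jwSign_*`
(`FermionOperatorsProofs`), `hubbardOpenBoxTT'`, `rectBoxGraph`, `rectBoxDiagGraph`, `lineAdj`
(`HubbardNNNHoppingOpenClusters`). `lean search 'testBit.*jwSign|code.*Finset.*Orb|bitCount'`: nothing
of this kind in the tree (the Jordan–Wigner file `HubbardJordanWigner` maps to `(ℂ⁴)^{⊗Λ}`, not to
integer codes).

## References

* P. Jordan, E. Wigner, Z. Phys. 47 (1928) 631. [cite: JordanWigner1928]
* F. H. L. Essler et al., *The One-Dimensional Hubbard Model* (2005), §2.1, §12.3.4.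
  [cite: EsslerEtAl2005, §2.1]
* H. Q. Lin, J. E. Gubernatis, Comput. Phys. 7 (1993) 400, §II. [cite: LinGubernatis1993, §II]
-/

namespace Literature.MathematicalPhysics.QuantumLattice

namespace OccupationCode

open Finset Matrix

/-! ### §1 Bits -/

/-- The number of set bits of `m` strictly below position `k`. [cite: LinGubernatis1993, §II] -/
def bitCount (m : ℕ) : ℕ → ℕ
  | 0 => 0
  | k + 1 => bitCount m k + (if m.testBit k then 1 else 0)

/-- The binary code `Σ_{i ∈ S} 2^i` of a finite set of naturals. [cite: LinGubernatis1993, §II] -/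
def natCode (S : Finset ℕ) : ℕ := ∑ i ∈ S, 2 ^ i

/-- Bit `j` of the code of `S` is set iff `j ∈ S`. [cite: LinGubernatis1993, §II] -/
theorem testBit_natCode (S : Finset ℕ) (j : ℕ) : (natCode S).testBit j = true ↔ j ∈ S := by
  rw [← Nat.mem_bitIndices, ← List.mem_toFinset, natCode, Finset.toFinset_bitIndices_sum_two_pow]

/-- `bitCount (natCode S) k = #{i ∈ S | i < k}`. [cite: LinGubernatis1993, §II] -/
theorem bitCount_natCode (S : Finset ℕ) : ∀ k : ℕ, bitCount (natCode S) k = (S.filter (· < k)).card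
  | 0 => by simp [bitCount]
  | k + 1 => by
    rw [bitCount, bitCount_natCode S k]
    have hsplit : S.filter (· < k + 1) = S.filter (· < k) ∪ S.filter (· = k) := by
      ext i
      simp only [mem_filter, mem_union]
      constructor
      · rintro ⟨hi, h⟩
        rcases Nat.lt_succ_iff_lt_or_eq.1 h with h | h
        exacts [Or.inl ⟨hi, h⟩, Or.inr ⟨hi, h⟩]
      · rintro (⟨hi, h⟩ | ⟨hi, h⟩)
        exacts [⟨hi, by omega⟩, ⟨hi, by omega⟩]
    have hdisj : Disjoint (S.filter (· < k)) (S.filter (· = k)) := by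
      rw [disjoint_filter]; intro i _ h; omega
    rw [hsplit, card_union_of_disjoint hdisj]
    congr 1
    by_cases hk : k ∈ S
    · rw [if_pos ((testBit_natCode S k).2 hk)]
      rw [show S.filter (· = k) = {k} from by ext i; simp only [mem_filter, mem_singleton]; exact
        ⟨fun h => h.2, fun h => ⟨h ▸ hk, h⟩⟩]
      rfl
    · rw [if_neg (fun h => hk ((testBit_natCode S k).1 h))]
      rw [show S.filter (· = k) = ∅ from by
        ext i; simp only [mem_filter, Finset.notMem_empty, iff_false]; rintro ⟨hi, rfl⟩; exact hk hi]
      rfl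

/-- `natCode (insert j S) = natCode S + 2^j` for `j ∉ S`. [cite: LinGubernatis1993, §II] -/
theorem natCode_insert {S : Finset ℕ} {j : ℕ} (h : j ∉ S) : natCode (insert j S) = natCode S + 2 ^ j := by
  rw [natCode, sum_insert h, natCode, add_comm]

/-- `natCode (S.erase j) = natCode S - 2^j` for `j ∈ S`. [cite: LinGubernatis1993, §II] -/
theorem natCode_erase {S : Finset ℕ} {j : ℕ} (h : j ∈ S) : natCode (S.erase j) = natCode S - 2 ^ j := by
  have := add_sum_erase S (fun i => 2 ^ i) h
  rw [natCode, natCode]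
  omega

/-- `natCode` is injective (binary expansions are unique). [cite: LinGubernatis1993, §II] -/
theorem natCode_injective : Function.Injective natCode := Finset.geomSum_injective le_rfl

/-! ### §2 Orbital ranks and codes of the open `a × b` box -/

section Box

variable {a b : ℕ}

/-- The rank `i·b + j` of the site `(i, j)` of the open `a × b` box (row-major = the lexicographic
order of `Fin a ×ₗ Fin b`). [cite: LinGubernatis1993, §II] -/
def siteRank (x : Fin a ×ₗ Fin b) : ℕ := ((ofLex x).1 : ℕ) * b + ((ofLex x).2 : ℕ)

/-- The rank `2·(i·b + j) + σ` of the orbital `((i, j), σ)` (site-major, spin `↑` before `↓` = the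
lexicographic order of `Orb (Fin a ×ₗ Fin b)`). [cite: LinGubernatis1993, §II] -/
def orbRank (o : Orb (Fin a ×ₗ Fin b)) : ℕ := 2 * siteRank (ofLex o).1 + ((ofLex o).2 : ℕ)

/-- Site ranks are `< a·b`. [cite: LinGubernatis1993, §II] -/
theorem siteRank_lt_mul (x : Fin a ×ₗ Fin b) : siteRank x < a * b := by
  unfold siteRank
  have h1 := (ofLex x).1.isLt
  have h2 := (ofLex x).2.isLt
  calc ((ofLex x).1 : ℕ) * b + ((ofLex x).2 : ℕ) < ((ofLex x).1 : ℕ) * b + b := by omega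
    _ = (((ofLex x).1 : ℕ) + 1) * b := by ring
    _ ≤ a * b := Nat.mul_le_mul_right _ h1

/-- `siteRank` is strictly monotone for the lexicographic (row-major) order. [cite: LinGubernatis1993, §II] -/
theorem siteRank_lt_iff (x y : Fin a ×ₗ Fin b) : siteRank x < siteRank y ↔ x < y := by
  obtain ⟨⟨i, j⟩, rfl⟩ : ∃ p : Fin a × Fin b, toLex p = x := ⟨ofLex x, toLex_ofLex x⟩
  obtain ⟨⟨i', j'⟩, rfl⟩ : ∃ p : Fin a × Fin b, toLex p = y := ⟨ofLex y, toLex_ofLex y⟩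
  simp only [siteRank, ofLex_toLex, Prod.Lex.toLex_lt_toLex, Fin.lt_def]
  have hj := j.isLt
  have hj' := j'.isLt
  constructor
  · intro h
    rcases lt_trichotomy (i : ℕ) i' with hii | hii | hii
    · exact Or.inl hii
    · have : (i : ℕ) * b = (i' : ℕ) * b := by rw [hii]
      exact Or.inr ⟨Fin.ext hii, by omega⟩
    · exfalso
      have h1 : ((i' : ℕ) + 1) * b ≤ (i : ℕ) * b := Nat.mul_le_mul_right _ hii
      nlinarith
  · rintro (hii | ⟨hii, hjj⟩)
    · have h1 : ((i : ℕ) + 1) * b ≤ (i' : ℕ) * b := Nat.mul_le_mul_right _ hii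
      nlinarith
    · rw [hii]
      omega

/-- `siteRank` is injective. [cite: LinGubernatis1993, §II] -/
theorem siteRank_injective : Function.Injective (siteRank (a := a) (b := b)) := by
  intro x y h
  rcases lt_trichotomy x y with hxy | hxy | hxy
  · exact absurd h (ne_of_lt ((siteRank_lt_iff x y).2 hxy))
  · exact hxy
  · exact absurd h.symm (ne_of_lt ((siteRank_lt_iff y x).2 hxy))

/-- `orbRank` is strictly monotone for the lexicographic order of `Orb (Fin a ×ₗ Fin b)` (site-major,
`↑` before `↓`). [cite: LinGubernatis1993, §II] -/
theorem orbRank_lt_iff (o o' : Orb (Fin a ×ₗ Fin b)) : orbRank o < orbRank o' ↔ o < o' := by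
  obtain ⟨⟨x, σ⟩, rfl⟩ : ∃ p : (Fin a ×ₗ Fin b) × Fin 2, toLex p = o := ⟨ofLex o, toLex_ofLex o⟩
  obtain ⟨⟨y, τ⟩, rfl⟩ : ∃ p : (Fin a ×ₗ Fin b) × Fin 2, toLex p = o' := ⟨ofLex o', toLex_ofLex o'⟩
  simp only [orbRank, ofLex_toLex, Prod.Lex.toLex_lt_toLex, Fin.lt_def]
  have hσ := σ.isLt
  have hτ := τ.isLt
  constructor
  · intro h
    rcases lt_trichotomy (siteRank x) (siteRank y) with hxy | hxy | hxy
    · exact Or.inl ((siteRank_lt_iff x y).1 hxy)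
    · exact Or.inr ⟨siteRank_injective hxy, by omega⟩
    · omega
  · rintro (hxy | ⟨hxy, hστ⟩)
    · have := (siteRank_lt_iff x y).2 hxy
      omega
    · rw [hxy]
      omega

/-- `orbRank` is injective. [cite: LinGubernatis1993, §II] -/
theorem orbRank_injective : Function.Injective (orbRank (a := a) (b := b)) := by
  intro o o' h
  rcases lt_trichotomy o o' with hoo | hoo | hoo
  · exact absurd h (ne_of_lt ((orbRank_lt_iff o o').2 hoo))
  · exact hoo
  · exact absurd h.symm (ne_of_lt ((orbRank_lt_iff o' o).2 hoo))

/-- `orbRank < 2ab` (the codes are `< 4^{ab}`). [cite: LinGubernatis1993, §II] -/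
theorem orbRank_lt (o : Orb (Fin a ×ₗ Fin b)) : orbRank o < 2 * (a * b) := by
  unfold orbRank
  have h1 := siteRank_lt_mul (ofLex o).1
  have h2 := (ofLex o).2.isLt
  omega

/-- **The occupation code** `code s = Σ_{o ∈ s} 2^{orbRank o}` of a configuration of the open box.
[cite: LinGubernatis1993, §II] -/
def code (s : Finset (Orb (Fin a ×ₗ Fin b))) : ℕ := ∑ o ∈ s, 2 ^ orbRank o

/-- The code is the binary code of the set of ranks. [cite: LinGubernatis1993, §II] -/
theorem code_eq_natCode_image (s : Finset (Orb (Fin a ×ₗ Fin b))) :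
    code s = natCode (s.image orbRank) := by
  rw [code, natCode, sum_image fun o _ o' _ h => orbRank_injective h]

/-- `o ∈ s` iff bit `orbRank o` of `code s` is set. [cite: LinGubernatis1993, §II] -/
theorem mem_iff_testBit_code (s : Finset (Orb (Fin a ×ₗ Fin b))) (o : Orb (Fin a ×ₗ Fin b)) :
    o ∈ s ↔ (code s).testBit (orbRank o) = true := by
  rw [code_eq_natCode_image, testBit_natCode, mem_image]
  constructor
  · exact fun h => ⟨o, h, rfl⟩
  · rintro ⟨o', ho', h⟩
    rwa [← orbRank_injective h]

/-- `code (insert o s) = code s + 2^{orbRank o}` (`o ∉ s`). [cite: LinGubernatis1993, §II] -/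
theorem code_insert {s : Finset (Orb (Fin a ×ₗ Fin b))} {o : Orb (Fin a ×ₗ Fin b)} (h : o ∉ s) :
    code (insert o s) = code s + 2 ^ orbRank o := by
  rw [code, sum_insert h, code, add_comm]

/-- `code (s.erase o) = code s - 2^{orbRank o}` (`o ∈ s`). [cite: LinGubernatis1993, §II] -/
theorem code_erase {s : Finset (Orb (Fin a ×ₗ Fin b))} {o : Orb (Fin a ×ₗ Fin b)} (h : o ∈ s) :
    code (s.erase o) = code s - 2 ^ orbRank o := by
  have := add_sum_erase s (fun o => 2 ^ orbRank o) h
  rw [code, code]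
  omega

/-- An occupied orbital contributes its power of two to the code. [cite: LinGubernatis1993, §II] -/
theorem two_pow_le_code_of_mem {s : Finset (Orb (Fin a ×ₗ Fin b))} {o : Orb (Fin a ×ₗ Fin b)}
    (h : o ∈ s) : 2 ^ orbRank o ≤ code s := by
  rw [code]
  exact single_le_sum (f := fun o => 2 ^ orbRank o) (fun _ _ => Nat.zero_le _) h

/-- `code` is injective. [cite: LinGubernatis1993, §II] -/
theorem code_injective : Function.Injective (code (a := a) (b := b)) := by
  intro s s' h
  rw [code_eq_natCode_image, code_eq_natCode_image] at h
  have := natCode_injective h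
  exact (image_injective orbRank_injective) this

/-- **The Jordan–Wigner sign is the parity of the set bits below the orbital's rank**:
`jwSign o s = (-1)^{bitCount (code s) (orbRank o)}`. [cite: LinGubernatis1993, §II] -/
theorem jwSign_eq_neg_one_pow_bitCount (o : Orb (Fin a ×ₗ Fin b)) (s : Finset (Orb (Fin a ×ₗ Fin b))) :
    jwSign o s = (-1) ^ bitCount (code s) (orbRank o) := by
  rw [jwSign, code_eq_natCode_image, bitCount_natCode]
  congr 1
  rw [← card_image_of_injective (s.filter (· < o)) orbRank_injective, filter_image]
  have hf : s.filter (· < o) = s.filter (fun o' => orbRank o' < orbRank o) :=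
    filter_congr fun o' _ => (orbRank_lt_iff o' o).symm
  rw [hf]

end Box

/-! ### §3 Entries of hopping words and of the Hubbard Hamiltonian of a graph -/

section Entries

variable {ι : Type*} [LinearOrder ι] [Fintype ι]

/-- **Entry of a hopping word**: `(c†_i c_j) s s' = σ_i(u) σ_j(u)` with `u = s' ∖ {j}` if `j ∈ s'`,
`i ∉ u` and `s = u ∪ {i}`, and `0` otherwise (for `i = j` this is the number operator `[j ∈ s'][s = s']`).
[cite: EsslerEtAl2005, §2.1] -/
theorem creation_mul_annihilation_apply (i j : ι) (s s' : Finset ι) :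
    (creation i * annihilation j) s s' =
      if j ∈ s' ∧ i ∉ s'.erase j ∧ s = insert i (s'.erase j) then
        jwSign i (s'.erase j) * jwSign j (s'.erase j) else 0 := by
  rw [Matrix.mul_apply]
  by_cases hj : j ∈ s'
  · rw [Finset.sum_eq_single (s'.erase j)]
    · rw [annihilation_apply, if_pos ⟨notMem_erase j s', (insert_erase hj).symm⟩, creation_apply]
      by_cases h : i ∉ s'.erase j ∧ s = insert i (s'.erase j)
      · rw [if_pos h, if_pos ⟨hj, h⟩]
      · rw [if_neg h, if_neg (fun h' => h h'.2), zero_mul]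
    · intro u _ hu
      rw [annihilation_apply, if_neg, mul_zero]
      rintro ⟨hju, rfl⟩
      exact hu (erase_insert hju).symm
    · intro h; exact absurd (mem_univ _) h
  · rw [if_neg (fun h => hj h.1)]
    refine Finset.sum_eq_zero fun u _ => ?_
    rw [annihilation_apply, if_neg, mul_zero]
    rintro ⟨hju, rfl⟩
    exact hj (mem_insert_self j u)

variable {Λ : Type*} [LinearOrder Λ] [Fintype Λ]

/-- **Entries of the Hubbard Hamiltonian of a graph** in the occupation basis:
`H(t,U) s s' = -t Σ_{x,y,σ} [x ~ y] (c†_{xσ} c_{yσ}) s s' + U [s = s'] #{x : x↑, x↓ ∈ s}`.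
[cite: EsslerEtAl2005, §2.1] -/
theorem hamiltonian_apply (G : SimpleGraph Λ) [DecidableRel G.Adj] (t U : ℝ) (s s' : Finset (Orb Λ)) :
    hamiltonian G t U s s' =
      -(t : ℂ) * (∑ x : Λ, ∑ y : Λ, ∑ σ : Fin 2,
          if G.Adj x y then (creation (orb x σ) * annihilation (orb y σ)) s s' else 0) +
        (U : ℂ) * ∑ x : Λ, (numberOp x 0 * numberOp x 1) s s' := by
  rw [hamiltonian, Matrix.add_apply, Matrix.smul_apply, Matrix.smul_apply, smul_eq_mul, smul_eq_mul]
  congr 2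
  · rw [Matrix.sum_apply]
    refine Finset.sum_congr rfl fun x _ => ?_
    rw [Matrix.sum_apply]
    refine Finset.sum_congr rfl fun y _ => ?_
    rw [Matrix.sum_apply]
    refine Finset.sum_congr rfl fun σ _ => ?_
    split_ifs <;> rfl
  · rw [Matrix.sum_apply]

/-- Entry of the double occupancy of a site: `(n_{x↑} n_{x↓}) s s' = [s = s'][x↑ ∈ s][x↓ ∈ s]`.
[cite: EsslerEtAl2005, §2.1] -/
theorem numberOp_mul_numberOp_apply (x : Λ) (s s' : Finset (Orb Λ)) :
    (numberOp x 0 * numberOp x 1) s s' =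
      if s = s' then (if orb x 0 ∈ s then (if orb x 1 ∈ s then (1 : ℂ) else 0) else 0) else 0 := by
  rw [numberOp_mul_numberOp_eq_diagonal, diagonal_apply]
  by_cases hst : s = s'
  · subst hst
    by_cases h0 : orb x 0 ∈ s <;> by_cases h1 : orb x 1 ∈ s <;> simp [h0, h1]
  · simp [hst]

end Entries

end OccupationCode

end Literature.MathematicalPhysics.QuantumLattice
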